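import Summits.CriticalPhenomena.Ising3D.TaylorTableOddHeadReg
import Literature.MathematicalPhysics.QuantumFieldTheory.ConformalBootstrap3D.HRCoeffABIntervalBounds
import Literature.MathematicalPhysics.QuantumFieldTheory.ConformalBootstrap3D.PointKernelInterval
import Mathlib.Tactic.Linarith
import Mathlib.Tactic.Positivity
import Mathlib.Tactic.Ring
import HarnessLib

/-!
# The TABLE layer of a derivative certificate, X: rational mirrors of the `A(c,c)` interval tables (odd enclosures, part 1)
(cell `pub-ising3x`, seat boot-1 gen 6; gate (g2) — toward deciding `T.EnclosuresReg.2`)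

HONEST FRAMING: lottery ticket; floor = tightest certified 3D Ising CFT bounds; no exact-solution
claim without a proof.

Two of the three Dolan–Osborn coefficient families of an odd head term are of EQUAL-parameter type:
`c₊ = A_{n,j}(t/2, t/2; Δ, ℓ)/λ_ℓ` and `c₋ = A_{n,j}(-t/2, -t/2; Δ, ℓ)/λ_ℓ`, `t = Δσ - Δε`. Their Δ-uniform and
`c`-uniform enclosures on cells strictly above the unitarity bound are the tree's interval tables
`hrCoeffABLo/Hi c₁ c₂ Δ₁ Δ₂ ℓ n j` (`hrCoeffAB_self_mem_Icc_interval`, HRCoeffABIntervalBounds), stated over `ℝ`.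
This file gives their computable `ℚ` mirrors `hrCoeffABLoQ/HiQ` with cast theorems (the pattern of
`PointKernel.hrCoeffLoQ/HiQ`: the γ-enclosures are read at the shifted level `[Δ₁+n+2c₁, Δ₂+n+2c₂]`), and the
per-entry Boolean `selfCoeffEnclOK` with its soundness: a claimed rational interval contains
`A_{n,j}(c,c;Δ,ℓ)/λ_ℓ` for all `Δ ∈ [lo, hi]`, `c ∈ [c₁, c₂]` once `unitarityBound3D ℓ < lo`. (The signed family
`cₛ = A(-t/2, t/2)` and the regularised first-cell tables are the remaining items of DERIV-CERT-CHAIN §5b R3.)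
Sources: Dolan–Osborn 2004 §3 eqs. (3.11)–(3.12); Hogervorst–Rychkov 2013 §3 eq. (3.9). Elementary.
-/

namespace Summit.CriticalPhenomena.Ising3D

open Finset Set
open Literature.MathematicalPhysics.QuantumFieldTheory.ConformalBootstrap3D
open Literature.MathematicalPhysics.QuantumFieldTheory.ConformalBootstrap3D.PointKernel
  (casimirPivotQ cast_casimirPivotQ hrGammaPlusLoQ hrGammaPlusHiQ hrGammaMinusLoQ hrGammaMinusHiQ
    cast_hrGammaPlusLoQ cast_hrGammaPlusHiQ cast_hrGammaMinusLoQ cast_hrGammaMinusHiQ legendreLamQ cast_legendreLamQ)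
open Literature.Analysis.ValidatedNumerics (vget vtab vget_vtab vget_of_length_le)

/-- One step of the LOWER `A(c,c)` interval recursion on a tabulated level (γ's at the shifted level, pivot at `Δ₂`).
[cite: DolanOsborn2004, §3 eq. (3.12)] -/
def hrStepABLoQ (c₁ c₂ Δ₁ Δ₂ : ℚ) (ℓ n : ℕ) (row : List ℚ) (j : ℕ) : ℚ :=
  if InDescendantRange ℓ (n + 1) j then
    ((if j = 0 then 0 else hrGammaPlusLoQ (Δ₁ + n + 2 * c₁) (Δ₂ + n + 2 * c₂) (j - 1) * vget row (j - 1)) +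
        hrGammaMinusLoQ (Δ₁ + n + 2 * c₁) (Δ₂ + n + 2 * c₂) (j + 1) * vget row (j + 1)) /
      casimirPivotQ Δ₂ ℓ (n + 1) j
  else 0

/-- One step of the UPPER `A(c,c)` interval recursion (pivot at `Δ₁`). [cite: DolanOsborn2004, §3 eq. (3.12)] -/
def hrStepABHiQ (c₁ c₂ Δ₁ Δ₂ : ℚ) (ℓ n : ℕ) (row : List ℚ) (j : ℕ) : ℚ :=
  if InDescendantRange ℓ (n + 1) j then
    ((if j = 0 then 0 else hrGammaPlusHiQ (Δ₁ + n + 2 * c₁) (Δ₂ + n + 2 * c₂) (j - 1) * vget row (j - 1)) +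
        hrGammaMinusHiQ (Δ₁ + n + 2 * c₁) (Δ₂ + n + 2 * c₂) (j + 1) * vget row (j + 1)) /
      casimirPivotQ Δ₁ ℓ (n + 1) j
  else 0

/-- Level `n` of the lower table as a list (`j = 0, …, ℓ + n`). [cite: DolanOsborn2004, §3 eq. (3.12)] -/
def hrRowABLoQ (c₁ c₂ Δ₁ Δ₂ : ℚ) (ℓ : ℕ) : ℕ → List ℚ
  | 0 => vtab (ℓ + 1) fun j => if j = ℓ then 1 else 0
  | n + 1 => vtab (ℓ + n + 2) (hrStepABLoQ c₁ c₂ Δ₁ Δ₂ ℓ n (hrRowABLoQ c₁ c₂ Δ₁ Δ₂ ℓ n))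

/-- Level `n` of the upper table as a list. [cite: DolanOsborn2004, §3 eq. (3.12)] -/
def hrRowABHiQ (c₁ c₂ Δ₁ Δ₂ : ℚ) (ℓ : ℕ) : ℕ → List ℚ
  | 0 => vtab (ℓ + 1) fun j => if j = ℓ then 1 else 0
  | n + 1 => vtab (ℓ + n + 2) (hrStepABHiQ c₁ c₂ Δ₁ Δ₂ ℓ n (hrRowABHiQ c₁ c₂ Δ₁ Δ₂ ℓ n))

/-- `hrCoeffABLo` over `ℚ`. [cite: DolanOsborn2004, §3 eq. (3.12)] -/
def hrCoeffABLoQ (c₁ c₂ Δ₁ Δ₂ : ℚ) (ℓ n j : ℕ) : ℚ := vget (hrRowABLoQ c₁ c₂ Δ₁ Δ₂ ℓ n) j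

/-- `hrCoeffABHi` over `ℚ`. [cite: DolanOsborn2004, §3 eq. (3.12)] -/
def hrCoeffABHiQ (c₁ c₂ Δ₁ Δ₂ : ℚ) (ℓ n j : ℕ) : ℚ := vget (hrRowABHiQ c₁ c₂ Δ₁ Δ₂ ℓ n) j

/-- [cite: DolanOsborn2004, §3 eq. (3.12)] -/
theorem cast_hrCoeffABLoQ (c₁ c₂ Δ₁ Δ₂ : ℚ) (ℓ : ℕ) :
    ∀ n j : ℕ, ((hrCoeffABLoQ c₁ c₂ Δ₁ Δ₂ ℓ n j : ℚ) : ℝ) = hrCoeffABLo (c₁ : ℝ) (c₂ : ℝ) (Δ₁ : ℝ) (Δ₂ : ℝ) ℓ n j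
  | 0, j => by
    unfold hrCoeffABLoQ hrRowABLoQ
    rw [hrCoeffABLo_zero]
    by_cases hj : j < ℓ + 1
    · rw [vget_vtab _ hj]
      split_ifs <;> simp
    · rw [vget_of_length_le (by simp [vtab]; omega), if_neg (by omega)]
      simp
  | n + 1, j => by
    unfold hrCoeffABLoQ
    simp only [hrRowABLoQ]
    rw [hrCoeffABLo_succ]
    by_cases hj : j < ℓ + n + 2
    · rw [vget_vtab _ hj]
      unfold hrStepABLoQ
      have h1 := cast_hrCoeffABLoQ c₁ c₂ Δ₁ Δ₂ ℓ n (j - 1)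
      have h2 := cast_hrCoeffABLoQ c₁ c₂ Δ₁ Δ₂ ℓ n (j + 1)
      unfold hrCoeffABLoQ at h1 h2
      by_cases hr : InDescendantRange ℓ (n + 1) j
      · rw [if_pos hr, if_pos hr]
        split_ifs with hj0
        · push_cast
          rw [h2, cast_hrGammaMinusLoQ, cast_casimirPivotQ]
          push_cast
          ring_nf
        · push_cast
          rw [h1, h2, cast_hrGammaPlusLoQ, cast_hrGammaMinusLoQ, cast_casimirPivotQ]
          push_cast
          ring_nf
      · rw [if_neg hr, if_neg hr]
        simp
    · rw [vget_of_length_le (by simp [vtab]; omega), if_neg (by unfold InDescendantRange; omega)]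
      simp

/-- [cite: DolanOsborn2004, §3 eq. (3.12)] -/
theorem cast_hrCoeffABHiQ (c₁ c₂ Δ₁ Δ₂ : ℚ) (ℓ : ℕ) :
    ∀ n j : ℕ, ((hrCoeffABHiQ c₁ c₂ Δ₁ Δ₂ ℓ n j : ℚ) : ℝ) = hrCoeffABHi (c₁ : ℝ) (c₂ : ℝ) (Δ₁ : ℝ) (Δ₂ : ℝ) ℓ n j
  | 0, j => by
    unfold hrCoeffABHiQ hrRowABHiQ
    rw [hrCoeffABHi_zero]
    by_cases hj : j < ℓ + 1
    · rw [vget_vtab _ hj]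
      split_ifs <;> simp
    · rw [vget_of_length_le (by simp [vtab]; omega), if_neg (by omega)]
      simp
  | n + 1, j => by
    unfold hrCoeffABHiQ
    simp only [hrRowABHiQ]
    rw [hrCoeffABHi_succ]
    by_cases hj : j < ℓ + n + 2
    · rw [vget_vtab _ hj]
      unfold hrStepABHiQ
      have h1 := cast_hrCoeffABHiQ c₁ c₂ Δ₁ Δ₂ ℓ n (j - 1)
      have h2 := cast_hrCoeffABHiQ c₁ c₂ Δ₁ Δ₂ ℓ n (j + 1)
      unfold hrCoeffABHiQ at h1 h2
      by_cases hr : InDescendantRange ℓ (n + 1) j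
      · rw [if_pos hr, if_pos hr]
        split_ifs with hj0
        · push_cast
          rw [h2, cast_hrGammaMinusHiQ, cast_casimirPivotQ]
          push_cast
          ring_nf
        · push_cast
          rw [h1, h2, cast_hrGammaPlusHiQ, cast_hrGammaMinusHiQ, cast_casimirPivotQ]
          push_cast
          ring_nf
      · rw [if_neg hr, if_neg hr]
        simp
    · rw [vget_of_length_le (by simp [vtab]; omega), if_neg (by unfold InDescendantRange; omega)]
      simp

/-- Per-entry check that a rational interval `I` contains `A_{n,j}(c,c;Δ,ℓ)/λ_ℓ` for all `Δ ∈ [lo, hi]`,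
`c ∈ [c₁, c₂]` (cells strictly above the unitarity bound). [folklore] -/
def selfCoeffEnclOK (ℓ : ℕ) (c₁ c₂ lo hi : ℚ) (q : ℕ × ℕ) (I : ℚ × ℚ) : Bool :=
  decide ((if ℓ = 0 then (1 / 2 : ℚ) else (ℓ : ℚ) + 1) < lo) &&
    decide (I.1 ≤ hrCoeffABLoQ c₁ c₂ lo hi ℓ q.1 q.2 / legendreLamQ ℓ) &&
    decide (hrCoeffABHiQ c₁ c₂ lo hi ℓ q.1 q.2 / legendreLamQ ℓ ≤ I.2)

/-- **Soundness of `selfCoeffEnclOK`.** [cite: DolanOsborn2004, §3 eqs. (3.11)–(3.12)] -/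
theorem selfCoeffEnclOK_sound {ℓ : ℕ} {c₁ c₂ lo hi : ℚ} {q : ℕ × ℕ} {I : ℚ × ℚ}
    (h : selfCoeffEnclOK ℓ c₁ c₂ lo hi q I = true) {c Δ : ℝ} (hc1 : (c₁ : ℝ) ≤ c) (hc2 : c ≤ c₂)
    (h1 : (lo : ℝ) ≤ Δ) (h2 : Δ ≤ hi) :
    (I.1 : ℝ) ≤ hrCoeffAB c c Δ ℓ q.1 q.2 / legendreLam ℓ ∧ hrCoeffAB c c Δ ℓ q.1 q.2 / legendreLam ℓ ≤ (I.2 : ℝ) := by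
  have hlam : 0 < legendreLam ℓ := legendreLam_pos ℓ
  simp only [selfCoeffEnclOK, Bool.and_eq_true, decide_eq_true_eq] at h
  obtain ⟨⟨hb, hL⟩, hU⟩ := h
  have hbound : unitarityBound3D ℓ < (lo : ℝ) := by
    have hb' : (((if ℓ = 0 then (1 / 2 : ℚ) else (ℓ : ℚ) + 1 : ℚ)) : ℝ) < (lo : ℝ) := by exact_mod_cast hb
    unfold unitarityBound3D
    split_ifs at hb' ⊢ with h0 <;> push_cast at hb' <;> exact hb'
  obtain ⟨_, hlow, hupp⟩ := hrCoeffAB_self_mem_Icc_interval hbound h1 h2 hc1 hc2 q.1 q.2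
  have hL' : ((I.1 : ℚ) : ℝ) ≤ ((hrCoeffABLoQ c₁ c₂ lo hi ℓ q.1 q.2 / legendreLamQ ℓ : ℚ) : ℝ) := by exact_mod_cast hL
  have hU' : ((hrCoeffABHiQ c₁ c₂ lo hi ℓ q.1 q.2 / legendreLamQ ℓ : ℚ) : ℝ) ≤ ((I.2 : ℚ) : ℝ) := by exact_mod_cast hU
  rw [Rat.cast_div, cast_hrCoeffABLoQ, cast_legendreLamQ] at hL'
  rw [Rat.cast_div, cast_hrCoeffABHiQ, cast_legendreLamQ] at hU'
  exact ⟨hL'.trans (div_le_div_of_nonneg_right hlow hlam.le), (div_le_div_of_nonneg_right hupp hlam.le).trans hU'⟩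

/-- **The two equal-parameter coefficients of an odd head term, enclosed decidably** (cells strictly above the bound):
with `c = (Δσ-Δε)/2 ∈ [c₁, c₂]` for `c₊` and `-c ∈ [-c₂, -c₁]` for `c₋`. [cite: DolanOsborn2004, §3 eqs. (3.11)–(3.12)] -/
theorem oddCoeffs_self_mem {ℓ : ℕ} {c₁ c₂ lo hi : ℚ} {q : ℕ × ℕ} {IP IM : ℚ × ℚ}
    (hP : selfCoeffEnclOK ℓ c₁ c₂ lo hi q IP = true) (hM : selfCoeffEnclOK ℓ (-c₂) (-c₁) lo hi q IM = true)
    {Δσ Δε Δ : ℝ} (hc1 : (c₁ : ℝ) ≤ (Δσ - Δε) / 2) (hc2 : (Δσ - Δε) / 2 ≤ c₂) (h1 : (lo : ℝ) ≤ Δ) (h2 : Δ ≤ hi) :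
    ((IP.1 : ℝ) ≤ (oddCoeffs Δσ Δε Δ ℓ q).2.1 ∧ (oddCoeffs Δσ Δε Δ ℓ q).2.1 ≤ (IP.2 : ℝ)) ∧
      ((IM.1 : ℝ) ≤ (oddCoeffs Δσ Δε Δ ℓ q).2.2 ∧ (oddCoeffs Δσ Δε Δ ℓ q).2.2 ≤ (IM.2 : ℝ)) := by
  refine ⟨?_, ?_⟩
  · simpa [oddCoeffs] using selfCoeffEnclOK_sound hP hc1 hc2 h1 h2
  · have hm1 : ((-c₂ : ℚ) : ℝ) ≤ -(Δσ - Δε) / 2 := by push_cast; linarith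
    have hm2 : -(Δσ - Δε) / 2 ≤ ((-c₁ : ℚ) : ℝ) := by push_cast; linarith
    simpa [oddCoeffs] using selfCoeffEnclOK_sound hM hm1 hm2 h1 h2

end Summit.CriticalPhenomena.Ising3D
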